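import Summits.HodgeConjecture.HodgeConjecture.Theorems.HeckePrymWeilAimedDescendingRationalModel
import Summits.HodgeConjecture.HodgeConjecture.Theorems.HeckePrymWeilAimedDescendingFrame
import Literature.AlgebraicGeometry.Motives.WeilFormSignatureOfHodgeRiemann
import Literature.AlgebraicGeometry.HodgeTheory.AbelianVarietyEndomorphismsHOne
import HarnessLib

/-!
# Crux `WeilSixfoldsSqrtMinus7` (stmt-HodgeConjecture-1260), line `hyperbolic-eightfold-descent` — the signature `(n, n)` of the rational model from Hodge–Riemann in degree one (G3, part 3)

Route `HeckePrymWeil`, sub-goal G3 (`stub_weilSignature`) of Stub 7 (aimed partner at `d = 7`).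
**`exists_posNeg_of_hodgeRiemannOne`**: given the rational degree-one model `(u, M, G, ω)` of
`(A, φ, h)` (`u` a rational `ℂ`-basis of `H¹(A(ℂ); ℂ)` on `Fin (4n)`, `φ^* uᵢ = Σ_k M k i • u_k`,
`Q_h(uᵢ, u_k) = G i k • ω`, `ω ≠ 0`, `M² = -7`, `G` alternating of Weil type `Mᵀ G M = 7 G`), the
sign-free HODGE–RIEMANN INEQUALITY IN DEGREE ONE for `Q_h` on `(1,0)`-classes
(`i · Q_h(x, x̄) ∈ ℝ_{>0} · ω₀` for one `ω₀ ≠ 0`; Voisin I Thm. 6.32 at `k = 1` — the hypothesis,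
a named fact of the tree's `Literature` layer for hyperplane classes) and the Weil typing
(`n`-dimensional `(1,0)`-typed pieces `T± ⊆ V_{± i√7}`, part 2), the symmetric form
`x ↦ x · G M x` on `ℚ^{4n}` has `M`-stable positive and negative definite `2n`-subspaces meeting in
`0` — van Geemen, LNM 1594, Lemma 5.2 (4) "the signature of `H` is `(n, n)`". The proof transports
to coordinates (`φ^*` is `M_ℂ` in the basis `u`; `conjClass` is coordinatewise conjugation, `u`
being rational hence real, `IsRationalClass.conjClass_eq`; `Q_h(x, y) = (x_u · G_ℂ y_u) ω`), reads
off ONE sign `ε` (the coefficient of `ω₀` along `ω` is real and non-zero, because `i · x G_ℂ x̄` is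
real for alternating `G`), and applies the coordinate theorem
`Motives.exists_posNeg_of_coordHodgeRiemann` (`Literature/AlgebraicGeometry/Motives/WeilFormSignatureOfHodgeRiemann`).

Sources: B. van Geemen, LNM 1594 (1994), Lemma 5.2 (4)–(5) with proof; C. Voisin, Hodge Theory I
(2002), Thm. 6.32. Everything from theorems of the tree; the Hodge–Riemann input is a HYPOTHESIS.
-/

noncomputable section

-- single-problem summit (Problem = Summit): the mandated namespace repeats `HodgeConjecture`.
set_option linter.dupNamespace false

open CategoryTheory Module
open scoped Matrix ComplexConjugate
open Literature.AlgebraicGeometry Literature.AlgebraicGeometry.Motives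
  Literature.AlgebraicGeometry.HodgeTheory Literature.AlgebraicTopology.SingularHomology
  Literature.Geometry.Kaehler

namespace Summit.HodgeConjecture.HodgeConjecture.Theorems.WeilSixfoldsSqrtMinus7.HyperbolicEightfoldDescent

section Transport


/-- **The signature of the rational model from Hodge–Riemann in degree one and the Weil
typing** (van Geemen, LNM 1594, Lemma 5.2 (4)–(5), read in a rational basis `u` of
`H¹(A(ℂ); ℂ)`). Given the model `(u, M, G, ω)` of `(A, φ, h)` (`M² = -7`, `G` alternating of
Weil type), the sign-free Hodge–Riemann inequality for `Q_h` on `(1,0)`-classes and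
`n`-dimensional `(1,0)`-typed pieces of the two eigenspaces `V_{±i√7}` of `φ^*`, the symmetric
form `x ↦ x · G M x` on `ℚ^{4n}` has an `M`-stable positive `2n`-space and an `M`-stable negative
`2n`-space meeting in `0`. [cite: vanGeemen1994HodgeAV, Lemma 5.2 (4)–(5) and proof] [cite: VoisinHodgeI2002, Thm. 6.32] -/
theorem exists_posNeg_of_hodgeRiemannOne :
    ∀ (n : ℕ) (A : AbelianVariety ℂ) (φ : A ⟶ A) (h : complexBetti A.X 2)
      (u : Fin (4 * n) → complexBetti A.X 1) (M G : Matrix (Fin (4 * n)) (Fin (4 * n)) ℚ)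
      (ω : complexBetti A.X (2 + 2 * (2 * n - 1))),
      1 ≤ n → A.dim = 2 * n → (∀ i, IsRationalClass (u i)) → LinearIndependent ℂ u →
      Submodule.span ℂ (Set.range u) = ⊤ →
      (∀ i, complexBetti.map φ.hom.hom.hom 1 (u i) = ∑ k, ((M k i : ℚ) : ℂ) • u k) → ω ≠ 0 →
      (∀ i k, polarizationPairingOne A.X h (2 * n - 1) (u i) (u k) = ((G i k : ℚ) : ℂ) • ω) →
      (∀ v, M.mulVec (M.mulVec v) = -((7 : ℚ) • v)) →
      (∀ x y : Fin (4 * n) → ℚ, y ⬝ᵥ G.mulVec x = -(x ⬝ᵥ G.mulVec y)) →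
      (∀ x y : Fin (4 * n) → ℚ, M.mulVec x ⬝ᵥ G.mulVec (M.mulVec y) = 7 * (x ⬝ᵥ G.mulVec y)) →
      (∃ ω₀ : complexBetti A.X (2 + 2 * (2 * n - 1)), ω₀ ≠ 0 ∧
        ∀ x : complexBetti A.X 1, IsOfHodgeType (2 * n) A.X 1 1 0 x → x ≠ 0 →
          ∃ r : ℝ, 0 < r ∧ Complex.I • polarizationPairingOne A.X h (2 * n - 1) x
            (conjClass (ComplexPoints A.X) 1 x) = (r : ℂ) • ω₀) →
      (∃ Tp Tm : Submodule ℂ (complexBetti A.X 1),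
        Module.finrank ℂ Tp = n ∧ Module.finrank ℂ Tm = n ∧
        (∀ x ∈ Tp, complexBetti.map φ.hom.hom.hom 1 x = (Complex.I * (Real.sqrt (7 : ℝ) : ℂ)) • x) ∧
        (∀ x ∈ Tm, complexBetti.map φ.hom.hom.hom 1 x = -(Complex.I * (Real.sqrt (7 : ℝ) : ℂ)) • x) ∧
        (∀ x ∈ Tp, IsOfHodgeType (2 * n) A.X 1 1 0 x) ∧ (∀ x ∈ Tm, IsOfHodgeType (2 * n) A.X 1 1 0 x)) →
      ∃ P N : Submodule ℚ (Fin (4 * n) → ℚ),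
        (∀ v ∈ P, M.mulVec v ∈ P) ∧ (∀ v ∈ N, M.mulVec v ∈ N) ∧
        Module.finrank ℚ P = 2 * n ∧ Module.finrank ℚ N = 2 * n ∧ P ⊓ N = ⊥ ∧
        (∀ x ∈ P, x ≠ 0 → 0 < x ⬝ᵥ G.mulVec (M.mulVec x)) ∧
        (∀ x ∈ N, x ≠ 0 → x ⬝ᵥ G.mulVec (M.mulVec x) < 0) := by
  intro n A φ h u M G ω hn hA hu hui husp hM hω0 hG hM2 hGt hW hHR hTY
  classical
  have hX : IsSmoothProjective ((2 * n - 1) + 1) A.X := by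
    have h := AbelianVariety.isSmoothProjective_holds (A := A)
    rw [AbelianVariety.isSmoothProjective, hA, show 2 * n = (2 * n - 1) + 1 by omega] at h
    exact h
  -- the rational basis and its coordinates
  let B : Module.Basis (Fin (4 * n)) ℂ (complexBetti A.X 1) := Module.Basis.mk hui (by rw [husp])
  have hB : ∀ i, B i = u i := fun i => Module.Basis.mk_apply hui _ i
  have hrepr : ∀ a : Fin (4 * n) → ℂ, B.equivFun (∑ k, a k • u k) = a := fun a => by
    have ha := B.equivFun_symm_apply a
    simp_rw [hB] at ha
    rw [← ha, LinearEquiv.apply_symm_apply]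
  have hexp : ∀ x : complexBetti A.X 1, x = ∑ i, B.equivFun x i • u i := fun x => by
    conv_lhs => rw [← B.sum_equivFun x]
    simp_rw [hB]
  -- `φ^*`, conjugation and `Q_h` in coordinates
  have hcoordφ : ∀ c : Fin (4 * n) → ℂ,
      B.equivFun (complexBetti.map φ.hom.hom.hom 1 (∑ i, c i • u i)) = M.map (Rat.castHom ℂ) *ᵥ c := fun c => by
    rw [map_sum]
    simp_rw [map_smul, hM]
    rw [Theorems.sum_smul_sum_smul_eq u (fun i k => M k i) c, hrepr]
    funext k
    simp only [Matrix.mulVec, dotProduct, Matrix.map_apply, Rat.coe_castHom]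
    exact Finset.sum_congr rfl fun i _ => mul_comm _ _
  have hcoordconj : ∀ c : Fin (4 * n) → ℂ,
      B.equivFun (conjClass (ComplexPoints A.X) 1 (∑ i, c i • u i)) = star c := fun c => by
    have h1 : conjClass (ComplexPoints A.X) 1 (∑ i, c i • u i) = ∑ i, (star c) i • u i := by
      rw [← conjClassEquiv_apply, map_sum]
      refine Finset.sum_congr rfl fun i _ => ?_
      rw [conjClassEquiv_apply, conjClass_smul, (hu i).conjClass_eq]
      rfl
    rw [h1, hrepr]
  have hcoordQ : ∀ c c' : Fin (4 * n) → ℂ,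
      polarizationPairingOne A.X h (2 * n - 1) (∑ i, c i • u i) (∑ k, c' k • u k) =
        (c ⬝ᵥ G.map (Rat.castHom ℂ) *ᵥ c') • ω := fun c c' => by
    rw [Theorems.bilin_sum_smul_sum_smul]
    simp_rw [hG, smul_smul, ← Finset.sum_smul]
    congr 1
    simp only [dotProduct, Matrix.mulVec, Matrix.map_apply, Rat.coe_castHom, Finset.mul_sum]
    exact Finset.sum_congr rfl fun i _ => Finset.sum_congr rfl fun k _ => by ring
  -- the complex Gram form is alternating; `x · G x̄` is purely imaginary
  have hGct : (G.map (Rat.castHom ℂ))ᵀ = -G.map (Rat.castHom ℂ) := by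
    have hGt' : Gᵀ = -G := Matrix.ext fun i k => by
      have h := hGt (Pi.single i 1) (Pi.single k 1)
      simp only [Matrix.mulVec_single_one, single_dotProduct, one_mul, Matrix.col_apply] at h
      rw [Matrix.transpose_apply, Matrix.neg_apply, h]
    rw [← Matrix.transpose_map, hGt']
    exact Matrix.map_neg _ (map_neg (Rat.castHom ℂ)) _
  have hGc : ∀ x y : Fin (4 * n) → ℂ, y ⬝ᵥ G.map (Rat.castHom ℂ) *ᵥ x = -(x ⬝ᵥ G.map (Rat.castHom ℂ) *ᵥ y) := fun x y => by
    rw [Matrix.dotProduct_mulVec, ← Matrix.mulVec_transpose, hGct, Matrix.neg_mulVec, neg_dotProduct,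
      dotProduct_comm]
  have hreal : ∀ z : Fin (4 * n) → ℂ,
      starRingEnd ℂ (Complex.I * (z ⬝ᵥ G.map (Rat.castHom ℂ) *ᵥ star z)) = Complex.I * (z ⬝ᵥ G.map (Rat.castHom ℂ) *ᵥ star z) := by
    intro z
    have hP : z ⬝ᵥ G.map (Rat.castHom ℂ) *ᵥ star z = -starRingEnd ℂ (z ⬝ᵥ G.map (Rat.castHom ℂ) *ᵥ star z) := by
      conv_lhs => rw [map_ratCast_mulVec_star, Matrix.dotProduct_star, dotProduct_comm, hGc]
      rw [star_neg, Complex.star_def]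
    rw [map_mul, Complex.conj_I]
    linear_combination (-Complex.I) * hP
  -- unpack the hypotheses
  obtain ⟨ω₀, hω₀0, hHR'⟩ := hHR
  obtain ⟨Tp, Tm, hTpn, hTmn, hTp, hTm, hTpH, hTmH⟩ := hTY
  have h1 := Theorems.finrank_complexBetti_two_add_two_mul_eq_one hX
  obtain ⟨c₀, hc₀⟩ := (finrank_eq_one_iff_of_nonzero' ω hω0).1 h1 ω₀
  have hc₀0 : c₀ ≠ 0 := fun h0 => hω₀0 (by rw [← hc₀, h0, zero_smul])
  -- the Hodge–Riemann value in coordinates: `i · (c G c̄) = r c₀`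
  have hval : ∀ x : complexBetti A.X 1, IsOfHodgeType (2 * n) A.X 1 1 0 x → x ≠ 0 →
      ∃ r : ℝ, 0 < r ∧
        Complex.I * (B.equivFun x ⬝ᵥ G.map (Rat.castHom ℂ) *ᵥ star (B.equivFun x)) = (r : ℂ) * c₀ := by
    intro x hxH hx0
    obtain ⟨r, hr, hrx⟩ := hHR' x hxH hx0
    refine ⟨r, hr, ?_⟩
    have ex : x = ∑ i, B.equivFun x i • u i := hexp x
    have h3 := hcoordconj (B.equivFun x)
    rw [← ex] at h3
    have hconj : conjClass (ComplexPoints A.X) 1 x = ∑ i, (star (B.equivFun x)) i • u i := by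
      rw [hexp (conjClass (ComplexPoints A.X) 1 x), h3]
    have hq : polarizationPairingOne A.X h (2 * n - 1) x (conjClass (ComplexPoints A.X) 1 x) =
        (B.equivFun x ⬝ᵥ G.map (Rat.castHom ℂ) *ᵥ star (B.equivFun x)) • ω := by
      have h2 := hcoordQ (B.equivFun x) (star (B.equivFun x))
      rw [← hconj, ← ex] at h2
      exact h2
    rw [hq, smul_smul, ← hc₀, smul_smul] at hrx
    exact smul_left_injective ℂ hω0 hrx
  -- `c₀` is real and non-zero: test at a non-zero vector of `Tp`
  have hc₀im : c₀.im = 0 := by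
    have hTp0 : Tp ≠ ⊥ := by
      intro hbot
      rw [hbot, finrank_bot] at hTpn
      omega
    obtain ⟨x₀, hx₀, hx₀0⟩ := Submodule.exists_mem_ne_zero_of_ne_bot hTp0
    obtain ⟨r₀, hr₀, hr₀x⟩ := hval x₀ (hTpH x₀ hx₀) hx₀0
    have him : (Complex.I * (B.equivFun x₀ ⬝ᵥ G.map (Rat.castHom ℂ) *ᵥ star (B.equivFun x₀))).im = 0 :=
      Complex.conj_eq_iff_im.1 (hreal _)
    rw [hr₀x, Complex.im_ofReal_mul] at him
    rcases mul_eq_zero.1 him with h0 | h0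
    · exact absurd h0 hr₀.ne'
    · exact h0
  have hc₀re : c₀.re ≠ 0 := fun h0 => hc₀0 (Complex.ext h0 hc₀im)
  -- the sign
  set ε : ℚ := if 0 < c₀.re then 1 else -1 with hεdef
  have hε : ε = 1 ∨ ε = -1 := by
    rw [hεdef]
    split_ifs
    · exact Or.inl rfl
    · exact Or.inr rfl
  have hεc : 0 < (ε : ℝ) * c₀.re := by
    rw [hεdef]
    split_ifs with hlt
    · push_cast
      linarith
    · push_cast
      have : c₀.re < 0 := lt_of_le_of_ne (not_lt.1 hlt) hc₀re
      linarith
  have hsign : ∀ x : complexBetti A.X 1, IsOfHodgeType (2 * n) A.X 1 1 0 x → x ≠ 0 →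
      0 < (ε : ℝ) * (Complex.I * (B.equivFun x ⬝ᵥ G.map (Rat.castHom ℂ) *ᵥ star (B.equivFun x))).re := by
    intro x hxH hx0
    obtain ⟨r, hr, hrx⟩ := hval x hxH hx0
    rw [hrx, Complex.re_ofReal_mul, mul_left_comm]
    exact mul_pos hr hεc
  -- coordinate subspaces
  set Tp' : Submodule ℂ (Fin (4 * n) → ℂ) := Tp.map (B.equivFun : complexBetti A.X 1 →ₗ[ℂ] _) with hTp'
  set Tm' : Submodule ℂ (Fin (4 * n) → ℂ) := Tm.map (B.equivFun : complexBetti A.X 1 →ₗ[ℂ] _) with hTm'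
  have hTp'n : Module.finrank ℂ Tp' = n := by rw [hTp', LinearEquiv.finrank_map_eq, hTpn]
  have hTm'n : Module.finrank ℂ Tm' = n := by rw [hTm', LinearEquiv.finrank_map_eq, hTmn]
  have h7 : ((7 : ℚ) : ℝ) = 7 := by norm_num
  have hTp'e : ∀ y ∈ Tp', M.map (Rat.castHom ℂ) *ᵥ y = (Complex.I * (Real.sqrt ((7 : ℚ) : ℝ) : ℂ)) • y := by
    intro y hy
    obtain ⟨x, hx, rfl⟩ := Submodule.mem_map.1 hy
    have h2 := hcoordφ (B.equivFun x)
    rw [← hexp x, hTp x hx, map_smul] at h2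
    rw [h7]
    exact h2.symm
  have hTm'e : ∀ y ∈ Tm', M.map (Rat.castHom ℂ) *ᵥ y = (-(Complex.I * (Real.sqrt ((7 : ℚ) : ℝ) : ℂ))) • y := by
    intro y hy
    obtain ⟨x, hx, rfl⟩ := Submodule.mem_map.1 hy
    have h2 := hcoordφ (B.equivFun x)
    rw [← hexp x, hTm x hx, map_smul] at h2
    rw [h7]
    exact h2.symm
  have hTp's : ∀ y ∈ Tp', y ≠ 0 → 0 < (ε : ℝ) * (Complex.I * (y ⬝ᵥ G.map (Rat.castHom ℂ) *ᵥ star y)).re := by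
    intro y hy hy0
    obtain ⟨x, hx, rfl⟩ := Submodule.mem_map.1 hy
    have hx0 : x ≠ 0 := fun h0 => hy0 (by rw [h0, map_zero])
    exact hsign x (hTpH x hx) hx0
  have hTm's : ∀ y ∈ Tm', y ≠ 0 → 0 < (ε : ℝ) * (Complex.I * (y ⬝ᵥ G.map (Rat.castHom ℂ) *ᵥ star y)).re := by
    intro y hy hy0
    obtain ⟨x, hx, rfl⟩ := Submodule.mem_map.1 hy
    have hx0 : x ≠ 0 := fun h0 => hy0 (by rw [h0, map_zero])
    exact hsign x (hTmH x hx) hx0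
  exact exists_posNeg_of_coordHodgeRiemann M G (d := 7) (by norm_num) hM2 hGt hW Tp' Tm' hTp'e hTm'e
    hTp'n hTm'n ε hε hTp's hTm's

end Transport

end Summit.HodgeConjecture.HodgeConjecture.Theorems.WeilSixfoldsSqrtMinus7.HyperbolicEightfoldDescent

end
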